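import Literature.AlgebraicGeometry.Frobenioids.CategoryTheoreticityFacts
import Literature.AlgebraicGeometry.Frobenioids.EquivalenceUnitsFrobeniusSlim
import Literature.AlgebraicGeometry.Frobenioids.EquivalenceDegreesGroupLike
import Literature.AlgebraicGeometry.Frobenioids.Thm34vSlim
import Literature.AlgebraicGeometry.Frobenioids.EquivalenceThm34Assembly
import Literature.AlgebraicGeometry.Frobenioids.EquivalencePreStepsThm34iiClosers
import HarnessLib

/-!
# Frobenioids I, Theorem 3.4 (iv) and (v) FROM Theorem 3.4 (ii) and (iii) — base-agnostic `_of` closers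

Mochizuki, *The geometry of Frobenioids I: the general theory*, Kyushu J. Math. **62** (2008)
293–400, Thm. 3.4 (iv) p. 62 l. 36 – p. 63 l. 4 and (v) p. 63 ll. 22–37
[cite: MochizukiFrdI2008, Thm. 3.4 (iv) p.63]; proof of (iv) p. 66 l. 13 – p. 67 l. 21 ("by assertion (iii),
`Ψ` preserves pull-back morphisms, base-isomorphisms … Proposition 3.3, (i) … Frobenius-compact"), proof of
(v) p. 67 l. 22 – p. 69 l. 9 [cite: MochizukiFrdI2008, Thm. 3.4 (v) p.67].

PROOF-ONLY file (seat abc-iut-w4-d088; GAP-LEDGER row G-L1d8-1 = "printed generality residual" of [FrdI]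
Thm. 3.4, DOWNSTREAM HALF per abc-iut-L1-lead R97 (2): Thm. 3.4 (iv)+(v) as `_of` closers parametrised by
the typed Thm. 3.4 (iii)). In print, the base categories `D₁, D₂` enter the proofs of (iv) and (v) ONLY through
assertions (ii) (group-like objects preserved — the case split "group-like type / not") and (iii) (the seven
morphism classes preserved; `Ψ^{ℕ≥1}`). This file makes that kernel-precise, for EVERY pair of Frobenioids
`C₁ → F_{Φ₁}`, `C₂ → F_{Φ₂}` and every equivalence `Ψ`, with NO hypothesis on `D₁, D₂` beyond those inside the
typed statements:

* `FrdI.thm34iv_ofFunctor_of_thm34ii_thm34iii`: the typed `PreFrobenioidData.Thm34ii` and `Thm34iii`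
  (abc-iut-L1-t3, `BaseCategoryTheoreticity.lean`) at `ofFunctor`, for `Ψ` and for `Ψ⁻¹`, imply the typed
  `PreFrobenioidData.Thm34iv` (preservation of `O^▷(−)`, `O^×(−)` — abc-iut-w4-d093's Prop. 3.3 (i) transport
  core `PreFrobenioid.map_mem_endSubmonoid_of_isFrobeniusSlim`; `Ψ^{ℕ≥1} = id` — the (iii) automorphism is the
  identity when non-group-like objects exist, and abc-iut-w4-d033's Frobenius-compact argument
  `FrdI.preservesDegFr_ofFunctor_of_isOfGroupLikeType` in group-like type);
* `FrdI.thm34v_ofFunctor_of_thm34iii`: the typed `Thm34iii` for `Ψ` and `Ψ⁻¹` implies the typed `Thm34v`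
  (abc-iut-L1-d4's `PreFrobenioid.thm34v_conclusion_of_preserves_baseIso` over slim bases);
* at the level of the cell's NAMED FACTS (`CategoryTheoreticityFacts.lean`): `FrdI.thm34iv_of_thm34ii_thm34iii :
  Thm34ii → Thm34iii → Thm34iv` and `FrdI.thm34v_of_thm34iii : Thm34iii → Thm34v` — so the facts (iv), (v)
  "open as typed" carry NO residual beyond that of (ii)/(iii) (GAP-LEDGER G-L1d8-1);
* instances: over bases of FSM-type the typed (v) at `ofFunctor` (`FrdI.thm34v_ofFunctor_of_isOfFSMType`; the
  typed (iv) there is abc-iut-w4-d093's `FrdI.thm34iv_ofFunctor_of_isOfFSMType`, re-derived here as a one-liner);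
  over bases of FSMFF-type in the author's revised (2024) sense the instances follow the minute abc-iut-L1-t11's
  `FrdI.thm34iii_ofFunctor_of_isOfFSMFFType2024` lands (companion file `Thm34ivvOverFSMFF2024.lean`).
Nothing of [FrdI] is restated as a named fact; no statement of the paper is strengthened; no new definition.
-/

namespace Literature.AlgebraicGeometry.Frobenioids

namespace FrdI

open CategoryTheory PreFrobenioidData

universe w v v' u u'

section Two

variable {D₁ : Type u} [Category.{v} D₁] {Φ₁ : D₁ᵒᵖ ⥤ CommMonCat.{w}} {C₁ : Type u'} [Category.{v'} C₁]
  {D₂ : Type u} [Category.{v} D₂] {Φ₂ : D₂ᵒᵖ ⥤ CommMonCat.{w}} {C₂ : Type u'} [Category.{v'} C₂]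
  {F₁ : C₁ ⥤ ElemFrobenioid Φ₁} {F₂ : C₂ ⥤ ElemFrobenioid Φ₂}

/-! ### The group-like dichotomy from the typed Thm. 3.4 (ii) -/

/-- **Dichotomy from the typed Thm. 3.4 (ii) for `Ψ` and `Ψ⁻¹`**: for Frobenioids of standard type (which
supplies (a) quasi-isotropic type and (d) FSMFF-type bases, the hypotheses of the typed `Thm34ii`), either both
`C₁`, `C₂` are of group-like type or both admit a non-group-like object (group-like objects are preserved by
`Ψ` and by `Ψ⁻¹` and are invariant under the unit/counit isomorphisms). [cite: MochizukiFrdI2008, Thm. 3.4 (ii) p.62] -/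
theorem groupLike_dichotomy_of_thm34ii (Ψ : C₁ ≌ C₂)
    (h2 : (ofFunctor Φ₁ F₁).Thm34ii (ofFunctor Φ₂ F₂) Ψ) (h2' : (ofFunctor Φ₂ F₂).Thm34ii (ofFunctor Φ₁ F₁) Ψ.symm)
    (hs₁ : (ofFunctor Φ₁ F₁).IsOfStandardType) (hs₂ : (ofFunctor Φ₂ F₂).IsOfStandardType) :
    ((ofFunctor Φ₁ F₁).IsOfGroupLikeType ∧ (ofFunctor Φ₂ F₂).IsOfGroupLikeType) ∨
      ((∃ A : C₁, ¬ (ofFunctor Φ₁ F₁).IsGroupLikeObj A) ∧ ∃ A : C₂, ¬ (ofFunctor Φ₂ F₂).IsGroupLikeObj A) := by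
  have hG := (h2 hs₁.quasiIsotropic hs₂.quasiIsotropic hs₁.fsmff hs₂.fsmff).2.2
  have hG' := (h2' hs₂.quasiIsotropic hs₁.quasiIsotropic hs₂.fsmff hs₁.fsmff).2.2
  -- reflection of group-likeness along `Ψ` and `Ψ⁻¹`
  have r₁ : ∀ A : C₁, (ofFunctor Φ₂ F₂).IsGroupLikeObj (Ψ.functor.obj A) → (ofFunctor Φ₁ F₁).IsGroupLikeObj A :=
    fun A hA => (ofFunctor_isGroupLikeObj F₁ A).2
      (PreFrobenioid.IsGroupLikeObj.of_iso F₁ (Ψ.unitIso.app A).symm ((ofFunctor_isGroupLikeObj F₁ _).1 (hG' hA)))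
  have r₂ : ∀ B : C₂, (ofFunctor Φ₁ F₁).IsGroupLikeObj (Ψ.inverse.obj B) → (ofFunctor Φ₂ F₂).IsGroupLikeObj B :=
    fun B hB => (ofFunctor_isGroupLikeObj F₂ B).2
      (PreFrobenioid.IsGroupLikeObj.of_iso F₂ (Ψ.counitIso.app B) ((ofFunctor_isGroupLikeObj F₂ _).1 (hG hB)))
  by_cases hg : (ofFunctor Φ₁ F₁).IsOfGroupLikeType ∧ (ofFunctor Φ₂ F₂).IsOfGroupLikeType
  · exact Or.inl hg
  · right
    rw [not_and_or, PreFrobenioidData.isOfGroupLikeType_iff, PreFrobenioidData.isOfGroupLikeType_iff,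
      not_forall, not_forall] at hg
    rcases hg with ⟨A, hA⟩ | ⟨B, hB⟩
    · exact ⟨⟨A, hA⟩, ⟨Ψ.functor.obj A, fun h' => hA (r₁ A h')⟩⟩
    · exact ⟨⟨Ψ.inverse.obj B, fun h' => hB (r₂ B h')⟩, ⟨B, hB⟩⟩

/-! ### Theorem 3.4 (iv) from (ii) and (iii) -/

/-- **[FrdI] Thm. 3.4 (iv), first two clauses, from the typed Thm. 3.4 (iii) for `Ψ` and `Ψ⁻¹`**: under
(a) standard type, (b) `HypB` and (c) `D₂` Frobenius-slim, `Ψ` carries `O^▷(A)` into `O^▷(Ψ A)` and `O^×(A)`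
into `O^×(Ψ A)` — printed route p. 66: "by assertion (iii), `Ψ` preserves pull-back morphisms,
base-isomorphisms …", then Prop. 3.3 (i) (abc-iut-w4-d093's transport core
`PreFrobenioid.map_mem_endSubmonoid_of_isFrobeniusSlim`, which needs exactly: `Ψ` preserves base-isomorphisms,
`Ψ⁻¹` preserves pull-back morphisms, `C₁` Frobenius-normalized, `D₂` Frobenius-slim).
[cite: MochizukiFrdI2008, Thm. 3.4 (iv) p.66] -/
theorem thm34iv_units_of_thm34iii (hF₁ : PreFrobenioid.IsFrobenioid F₁) (hF₂ : PreFrobenioid.IsFrobenioid F₂)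
    (Ψ : C₁ ≌ C₂) (h3 : (ofFunctor Φ₁ F₁).Thm34iii (ofFunctor Φ₂ F₂) Ψ)
    (h3' : (ofFunctor Φ₂ F₂).Thm34iii (ofFunctor Φ₁ F₁) Ψ.symm)
    (hs₁ : (ofFunctor Φ₁ F₁).IsOfStandardType) (hs₂ : (ofFunctor Φ₂ F₂).IsOfStandardType)
    (hB : (ofFunctor Φ₁ F₁).HypB (ofFunctor Φ₂ F₂) Ψ) (hslim₂ : IsFrobeniusSlim D₂) :
    (∀ (A : C₁) (α : End A), α ∈ (ofFunctor Φ₁ F₁).endSubmonoid A →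
        Ψ.functor.map α ∈ (ofFunctor Φ₂ F₂).endSubmonoid (Ψ.functor.obj A)) ∧
      ∀ (A : C₁) (α : Aut A), α ∈ (ofFunctor Φ₁ F₁).unitsSubgroup A →
        Ψ.functor.mapIso α ∈ (ofFunctor Φ₂ F₂).unitsSubgroup (Ψ.functor.obj A) := by
  have hB' : (ofFunctor Φ₂ F₂).HypB (ofFunctor Φ₁ F₁) Ψ.symm := fun h₂ h₁ => ⟨(hB h₁ h₂).2, (hB h₁ h₂).1⟩
  have hbi := (h3 hs₁ hs₂ hB).1.2.2.1
  have hpb' := (h3' hs₂ hs₁ hB').1.2.2.2.2.1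
  have hend : ∀ (A : C₁) (α : End A), α ∈ (ofFunctor Φ₁ F₁).endSubmonoid A →
      Ψ.functor.map α ∈ (ofFunctor Φ₂ F₂).endSubmonoid (Ψ.functor.obj A) := fun A f hf =>
    PreFrobenioid.map_mem_endSubmonoid_of_isFrobeniusSlim hF₁ hF₂ hs₁.frobeniusNormalized hslim₂ Ψ hbi hpb' f hf
  exact ⟨hend, fun A α hα => hend A (show End A from α.hom) hα⟩

/-- **[FrdI] Thm. 3.4 (iv), the clause "`Ψ^{ℕ≥1}` is the identity", from the typed Thm. 3.4 (ii) and (iii)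
for `Ψ` and `Ψ⁻¹`**: under (a), (b) and (c) `D₂` Frobenius-slim, `Ψ` preserves all Frobenius degrees — when
non-group-like objects exist on both sides the automorphism `Ψ^{ℕ≥1}` of (iii) is the identity ("this already
follows formally from assertion (iii)", p. 66 l. 42); in group-like type (dichotomy by (ii)) by the
Frobenius-compact argument p. 66 l. 42 – p. 67 l. 21 (abc-iut-w4-d033's
`FrdI.preservesDegFr_ofFunctor_of_isOfGroupLikeType`, fed with the units clause just proved and the automorphism
of (iii)). [cite: MochizukiFrdI2008, Thm. 3.4 (iv) p.66] -/
theorem preservesDegFr_of_thm34ii_thm34iii (hF₁ : PreFrobenioid.IsFrobenioid F₁)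
    (hF₂ : PreFrobenioid.IsFrobenioid F₂) (Ψ : C₁ ≌ C₂)
    (h2 : (ofFunctor Φ₁ F₁).Thm34ii (ofFunctor Φ₂ F₂) Ψ) (h2' : (ofFunctor Φ₂ F₂).Thm34ii (ofFunctor Φ₁ F₁) Ψ.symm)
    (h3 : (ofFunctor Φ₁ F₁).Thm34iii (ofFunctor Φ₂ F₂) Ψ)
    (h3' : (ofFunctor Φ₂ F₂).Thm34iii (ofFunctor Φ₁ F₁) Ψ.symm)
    (hs₁ : (ofFunctor Φ₁ F₁).IsOfStandardType) (hs₂ : (ofFunctor Φ₂ F₂).IsOfStandardType)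
    (hB : (ofFunctor Φ₁ F₁).HypB (ofFunctor Φ₂ F₂) Ψ) (hslim₂ : IsFrobeniusSlim D₂) :
    PreservesDegFr (ofFunctor Φ₁ F₁) (ofFunctor Φ₂ F₂) Ψ := by
  obtain ⟨-, ΨN, hΨN, hid⟩ := h3 hs₁ hs₂ hB
  rcases groupLike_dichotomy_of_thm34ii Ψ h2 h2' hs₁ hs₂ with ⟨hg₁, hg₂⟩ | ⟨hN₁, hN₂⟩
  · exact preservesDegFr_ofFunctor_of_isOfGroupLikeType hF₁ hF₂ Ψ hs₁ hs₂ hB hg₁ hg₂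
      (thm34iv_units_of_thm34iii hF₁ hF₂ Ψ h3 h3' hs₁ hs₂ hB hslim₂).2 ⟨ΨN, hΨN⟩
  · intro A B φ
    rw [hΨN φ, hid hN₁ hN₂]
    rfl

/-- **[FrdI] Thm. 3.4 (iv), preservation part AS TYPED (`PreFrobenioidData.Thm34iv` at `ofFunctor`), from the
typed Thm. 3.4 (ii) and (iii) for `Ψ` and `Ψ⁻¹`** — for EVERY pair of Frobenioids, no hypothesis on the bases
beyond those inside the typed statements: under (a) standard type, (b) `HypB`, (c) Frobenius-slim bases (only
`D₂`'s is used), `Ψ` preserves `O^▷(−)`, `O^×(−)` and Frobenius degrees. [cite: MochizukiFrdI2008, Thm. 3.4 (iv) p.63] -/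
theorem thm34iv_ofFunctor_of_thm34ii_thm34iii (hF₁ : PreFrobenioid.IsFrobenioid F₁)
    (hF₂ : PreFrobenioid.IsFrobenioid F₂) (Ψ : C₁ ≌ C₂)
    (h2 : (ofFunctor Φ₁ F₁).Thm34ii (ofFunctor Φ₂ F₂) Ψ) (h2' : (ofFunctor Φ₂ F₂).Thm34ii (ofFunctor Φ₁ F₁) Ψ.symm)
    (h3 : (ofFunctor Φ₁ F₁).Thm34iii (ofFunctor Φ₂ F₂) Ψ)
    (h3' : (ofFunctor Φ₂ F₂).Thm34iii (ofFunctor Φ₁ F₁) Ψ.symm) :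
    (ofFunctor Φ₁ F₁).Thm34iv (ofFunctor Φ₂ F₂) Ψ := fun hs₁ hs₂ hB _ hslim₂ =>
  ⟨(thm34iv_units_of_thm34iii hF₁ hF₂ Ψ h3 h3' hs₁ hs₂ hB hslim₂).1,
    (thm34iv_units_of_thm34iii hF₁ hF₂ Ψ h3 h3' hs₁ hs₂ hB hslim₂).2,
    preservesDegFr_of_thm34ii_thm34iii hF₁ hF₂ Ψ h2 h2' h3 h3' hs₁ hs₂ hB hslim₂⟩

/-! ### Theorem 3.4 (v) from (iii) -/

/-- **[FrdI] Thm. 3.4 (v) AS TYPED (`PreFrobenioidData.Thm34v` at `ofFunctor`), from the typed Thm. 3.4 (iii)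
for `Ψ` and `Ψ⁻¹`** — for EVERY pair of Frobenioids: under (a), (b) and (c) `D₁, D₂` slim, `Ψ` preserves
base-identity endomorphisms and base-equivalent pairs, and there is a `1`-unique `Ψ^Base : D₁ → D₂` with the
`1`-commutative square over `Base₁, Base₂`, both composites rigid (the single input "`Ψ`, `Ψ⁻¹` carry
base-isomorphisms to base-isomorphisms" of abc-iut-L1-d4's `PreFrobenioid.thm34v_conclusion_of_preserves_baseIso`
is the base-isomorphism clause of (iii); printed proof p. 67 l. 23: "by assertion (iii), `Ψ` preserves
base-isomorphisms and pull-back morphisms"). [cite: MochizukiFrdI2008, Thm. 3.4 (v) p.63] -/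
theorem thm34v_ofFunctor_of_thm34iii (hF₁ : PreFrobenioid.IsFrobenioid F₁) (hF₂ : PreFrobenioid.IsFrobenioid F₂)
    (Ψ : C₁ ≌ C₂) (h3 : (ofFunctor Φ₁ F₁).Thm34iii (ofFunctor Φ₂ F₂) Ψ)
    (h3' : (ofFunctor Φ₂ F₂).Thm34iii (ofFunctor Φ₁ F₁) Ψ.symm) :
    (ofFunctor Φ₁ F₁).Thm34v (ofFunctor Φ₂ F₂) Ψ := fun hs₁ hs₂ hB hslim₁ hslim₂ =>
  have hB' : (ofFunctor Φ₂ F₂).HypB (ofFunctor Φ₁ F₁) Ψ.symm := fun h₂ h₁ => ⟨(hB h₁ h₂).2, (hB h₁ h₂).1⟩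
  PreFrobenioid.thm34v_conclusion_of_preserves_baseIso hF₁ hF₂ Ψ hslim₁ hslim₂
    (fun _ _ f hf => (h3 hs₁ hs₂ hB).1.2.2.1 f hf) (fun _ _ f hf => (h3' hs₂ hs₁ hB').1.2.2.1 f hf)

/-! ### Instances over bases of FSM-type (Thm. 3.4 (ii), (iii) known there: abc-iut-L1-t13 / t11 / w4-d033) -/

/-- **The typed `PreFrobenioidData.Thm34v` at `ofFunctor` HOLDS for every pair of Frobenioids over bases of
FSM-type** (the cell's repaired base hypothesis; print: FSMFF-type — residual G-L1d8-1), by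
`thm34v_ofFunctor_of_thm34iii` and abc-iut-w4-d033's `FrdI.thm34iii_ofFunctor_of_isOfFSMType` for `Ψ`, `Ψ⁻¹`.
[cite: MochizukiFrdI2008, Thm. 3.4 (v) p.63] -/
theorem thm34v_ofFunctor_of_isOfFSMType (hF₁ : PreFrobenioid.IsFrobenioid F₁)
    (hF₂ : PreFrobenioid.IsFrobenioid F₂) (hD₁ : IsOfFSMType D₁) (hD₂ : IsOfFSMType D₂) (Ψ : C₁ ≌ C₂) :
    (ofFunctor Φ₁ F₁).Thm34v (ofFunctor Φ₂ F₂) Ψ :=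
  thm34v_ofFunctor_of_thm34iii hF₁ hF₂ Ψ (thm34iii_ofFunctor_of_isOfFSMType hF₁ hF₂ hD₁ hD₂ Ψ)
    (thm34iii_ofFunctor_of_isOfFSMType hF₂ hF₁ hD₂ hD₁ Ψ.symm)

/-- The typed `PreFrobenioidData.Thm34iv` at `ofFunctor` over bases of FSM-type, re-derived through
`thm34iv_ofFunctor_of_thm34ii_thm34iii` (agrees with abc-iut-w4-d093's `FrdI.thm34iv_ofFunctor_of_isOfFSMType`;
kept as a consistency check of the `_of` route). [cite: MochizukiFrdI2008, Thm. 3.4 (iv) p.63] -/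
theorem thm34iv_ofFunctor_of_isOfFSMType' (hF₁ : PreFrobenioid.IsFrobenioid F₁)
    (hF₂ : PreFrobenioid.IsFrobenioid F₂) (hD₁ : IsOfFSMType D₁) (hD₂ : IsOfFSMType D₂) (Ψ : C₁ ≌ C₂) :
    (ofFunctor Φ₁ F₁).Thm34iv (ofFunctor Φ₂ F₂) Ψ :=
  thm34iv_ofFunctor_of_thm34ii_thm34iii hF₁ hF₂ Ψ (thm34ii_ofFunctor_of_isOfFSMType hF₁ hF₂ hD₁ hD₂ Ψ)
    (thm34ii_ofFunctor_of_isOfFSMType hF₂ hF₁ hD₂ hD₁ Ψ.symm) (thm34iii_ofFunctor_of_isOfFSMType hF₁ hF₂ hD₁ hD₂ Ψ)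
    (thm34iii_ofFunctor_of_isOfFSMType hF₂ hF₁ hD₂ hD₁ Ψ.symm)

end Two

/-! ### At the level of the named facts of `CategoryTheoreticityFacts.lean` -/

/-- **The named fact [FrdI] Thm. 3.4 (iv) follows from the named facts Thm. 3.4 (ii) and (iii)** (all three
universally quantified over pairs of Frobenioids and equivalences; (ii), (iii) are applied to `Ψ` and to `Ψ⁻¹`).
[cite: MochizukiFrdI2008, Thm. 3.4 (iv) p.63] -/
theorem thm34iv_of_thm34ii_thm34iii (h2 : Thm34ii.{w, v, v', u, u'}) (h3 : Thm34iii.{w, v, v', u, u'}) :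
    Thm34iv.{w, v, v', u, u'} := fun F₁ F₂ hF₁ hF₂ Ψ =>
  thm34iv_ofFunctor_of_thm34ii_thm34iii hF₁ hF₂ Ψ (h2 F₁ F₂ hF₁ hF₂ Ψ) (h2 F₂ F₁ hF₂ hF₁ Ψ.symm)
    (h3 F₁ F₂ hF₁ hF₂ Ψ) (h3 F₂ F₁ hF₂ hF₁ Ψ.symm)

/-- **The named fact [FrdI] Thm. 3.4 (v) follows from the named fact Thm. 3.4 (iii)** (applied to `Ψ` and
`Ψ⁻¹`). [cite: MochizukiFrdI2008, Thm. 3.4 (v) p.63] -/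
theorem thm34v_of_thm34iii (h3 : Thm34iii.{w, v, v', u, u'}) : Thm34v.{w, v, v', u, u'} :=
  fun F₁ F₂ hF₁ hF₂ Ψ =>
    thm34v_ofFunctor_of_thm34iii hF₁ hF₂ Ψ (h3 F₁ F₂ hF₁ hF₂ Ψ) (h3 F₂ F₁ hF₂ hF₁ Ψ.symm)

end FrdI

end Literature.AlgebraicGeometry.Frobenioids
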